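import Summits.QuantumFields.YangMills.Theorems.AllWindowsColdBoxGaussSideFourthMoment
import Summits.QuantumFields.YangMills.Theorems.AllWindowsColdBoxGaussSideCovariance
import Summits.QuantumFields.YangMills.Theorems.AllWindowsColdBoxGaussSideTiltTerm
import Summits.QuantumFields.YangMills.Theorems.AllWindowsColdBoxDirFreeVarLinear
import Summits.QuantumFields.YangMills.Theorems.AllWindowsColdBoxDirPoincareCubic
import Summits.QuantumFields.YangMills.Theorems.WeakCouplingRatesColdBoxTiltBound
import HarnessLib

/-!
# LINE-17 «hypercontractive second-order tilt expansion» on crux `AllWindowsColdBox.BoxMidWindowsSU22` (stmt-QuantumFields-24003):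
# registered stub F `stub_gaussSideTerms`, BY NAME AND SIGNATURE

`stub_gaussSideTerms : DirFreeVarLinear → DirPoincareCubic → ∀ θ, 0 < θ → θ ≤ 1/16 → GaussSideTerms θ` (STUB-PLAN-E-24003 §5 of
planner ym-idea-2): the three clauses of `GaussSideTerms θ` are F(i) `gaussSide_fourthMoment` (for both plaquettes, which touch the
cold box by `centre_mem_plaquettesTouching`), F(ii) `gaussSide_covariance` and F(iii) `gaussSide_tiltTerm`, with the common constant
`K = K₁ + K₂ + K₃` and the latest of the thresholds.  The two named inputs C (`DirFreeVarLinear`) and D (`DirPoincareCubic`) of the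
registered signature are not used beyond the tree theorems already invoked inside those files, so they are taken anonymously.

No definition; standard axioms.  HONEST LABEL: ONE registered stub (F) of one critic-PASSed line on the R2ξ″ RECORD-rung crux 24003;
with stubs B, C, D, E, G already landed this completes the line's registered stub list, but the crux item is closed only by the LEAD's
skeleton census / the gate — no crux, rung or summit is claimed here; the Yang–Mills mass gap is NOT proved by this file.
-/

set_option autoImplicit false

noncomputable section

open MeasureTheory
open Literature.MathematicalPhysics.QuantumLattice
open Literature.MathematicalPhysics.QuantumFieldTheory
open Summit.QuantumFields.YangMills.Theorems.WeakCouplingRates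
open Summit.QuantumFields.YangMills.Theorems.ColdBoxAllGroups
open Summit.QuantumFields.YangMills.Theorems.FreeEnergyLogCoefficient
open Summit.QuantumFields.YangMills.Theorems.AllWindowsColdBoxDirFreeVar (DirFreeVarLinear)
open Summit.QuantumFields.YangMills.Theorems.AllWindowsColdBox.DirPoincare (DirPoincareCubic)

namespace Summit.QuantumFields.YangMills.Theorems.AllWindowsColdBoxBoxMidLine

/-- **STUB F of LINE-17 (crux stmt-QuantumFields-24003), by name and registered signature**: for `0 < θ ≤ 1/16`, `GaussSideTerms θ` —
for every admissible single-link density, eventually in `β` and uniformly in `T ≤ ⌈β^θ⌉`: (i) the centred fourth moments of `obsF` and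
`obsG T` under `ν = lineGauss θ β` are `≤ K`; (ii) `|Cov_ν(obsF, obsG T) − ¾·boxDirCircSqCov ⌈β^θ⌉ T| ≤ K⌈β^θ⌉⁶/β`; (iii)
`|∫ (obsF − E obsF)(obsG T − E obsG T)·centredTilt dν| ≤ K⌈β^θ⌉⁶/β`.  Proof: `gaussSide_fourthMoment` + `gaussSide_covariance` +
`gaussSide_tiltTerm`. -/
theorem stub_gaussSideTerms : DirFreeVarLinear → DirPoincareCubic → ∀ θ : ℝ, 0 < θ → θ ≤ 1 / 16 → GaussSideTerms θ := by
  intro _ _ θ hθ hθ16 r₂ C₂ J hJ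
  obtain ⟨K₁, β₁, hK₁, h1⟩ := gaussSide_fourthMoment hθ hθ16
  obtain ⟨K₂, β₂, hK₂, h2⟩ := gaussSide_covariance hθ hθ16
  obtain ⟨K₃, β₃, hK₃, h3⟩ := gaussSide_tiltTerm hθ hθ16 hJ
  refine ⟨K₁ + K₂ + K₃, max (max β₁ β₂) (max β₃ 1), by positivity, fun β hβ T hT => ?_⟩
  have hβ₁ : β₁ ≤ β := le_trans (le_max_left _ _) ((le_max_left _ _).trans hβ)
  have hβ₂ : β₂ ≤ β := le_trans (le_max_right _ _) ((le_max_left _ _).trans hβ)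
  have hβ₃ : β₃ ≤ β := le_trans (le_max_left _ _) ((le_max_right _ _).trans hβ)
  have hβ1 : 1 ≤ β := le_trans (le_max_right _ _) ((le_max_right _ _).trans hβ)
  have hβ0 : 0 < β := by linarith
  have hHr : (1 : ℝ) ≤ (⌈β ^ θ⌉₊ : ℝ) := (one_le_ceil_rpow_and_le hβ1 hθ.le).1
  have hH : 1 ≤ ⌈β ^ θ⌉₊ := by exact_mod_cast hHr
  obtain ⟨hxm, hym⟩ := centre_mem_plaquettesTouching hH hT
  have hrate : 0 ≤ (⌈β ^ θ⌉₊ : ℝ) ^ 6 / β := by positivity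
  have hK : K₂ * (⌈β ^ θ⌉₊ : ℝ) ^ 6 / β ≤ (K₁ + K₂ + K₃) * (⌈β ^ θ⌉₊ : ℝ) ^ 6 / β := by
    rw [mul_div_assoc, mul_div_assoc]; exact mul_le_mul_of_nonneg_right (by linarith) hrate
  have hK' : K₃ * (⌈β ^ θ⌉₊ : ℝ) ^ 6 / β ≤ (K₁ + K₂ + K₃) * (⌈β ^ θ⌉₊ : ℝ) ^ 6 / β := by
    rw [mul_div_assoc, mul_div_assoc]; exact mul_le_mul_of_nonneg_right (by linarith) hrate
  refine ⟨?_, ?_, (h2 β hβ₂ T hT).trans hK, (h3 β hβ₃ T hT).trans hK'⟩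
  · unfold obsF
    exact (h1 β hβ₁ _ hxm).trans (by linarith)
  · unfold obsG
    exact (h1 β hβ₁ _ hym).trans (by linarith)

end Summit.QuantumFields.YangMills.Theorems.AllWindowsColdBoxBoxMidLine

end
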